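import Mathlib
import HarnessLib
import Summits.Parity.Statement
import Summits.Parity.BatemanHorn.Theses.OneSidedDegreeLadder
import Summits.Parity.BatemanHorn.Theses.DegreeExcessLadder
import Summits.Parity.BatemanHorn.Theorems.LowerNonlinearGlue
import Literature.NumberTheory.Sieve.BatemanHornProofs

/-!
# Route `DegreeExcessLadder` — exactness and necessity of the cut (hand (a), THEOREMS ONLY)

decomp-parity node B1.2 «DegreeExcessLadder» (lens-1 g7 kernel
`HOME/decomp-parity-lens-1/g7/DegreeExcessLadder.lean` §3–§4, critic CLEARED CRITIC-LEDGER row 83 / as born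
row 87a; route `route-Parity-DegreeExcessLadder` rev 1 d59967a8ab45), RE-POINTED at the born module
`Summits.Parity.BatemanHorn.Theses.DegreeExcessLadder` by lens-1 g8 (writer LANDING LIST L6).

Inside `namespace Summit.Parity.BatemanHorn.Theses.DegreeExcessLadder` the names `SinglePg`, `ExcessLift`,
`ChenQuad`, `ParityLift`, `UpperNonlinear`, `LinearCell` are the BORN route decls (stmt-Parity-32513 /
32514 and the record items shared by signature); `OneSidedDegreeLadder.ChenRest` / `.LowerNonlinear` are the
record route's decls (stmt-Parity-26566 / 25177).  Content:

* §0 the born copies of the shared record items are the record decls (`Iff.rfl`);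
* §1 one-member bookkeeping for systems `![q]`;
* §2 EXACTNESS of the cut, hypothesis-free: `ChenRest ↔ SinglePg ∧ ExcessLift` (`chenRest_iff_pieces`), with
  both necessity edges and the glue `SinglePg → ExcessLift → ChenRest`;
* §3 NECESSITY from the leaf `LowerNonlinear`, the conjunct `BatemanHorn` and the root `Parity`, and the
  six-way exactness of the route through its BORN deciding theorem `closes`
  (`batemanHorn_iff_pieces`, `lowerNonlinear_iff_pieces4`).

No `sorry`, standard axioms; no statement items are touched (D-0026: theorems only).
-/

open Filter Finset Polynomial Asymptotics
open scoped Topology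

open Literature.NumberTheory.Sieve

namespace Summit.Parity.BatemanHorn.Theses.DegreeExcessLadder

/-! ## §0 The born copies of the shared record items ARE the record items -/

/-- The born `ChenQuad` is the record route's `ChenQuad` (stmt-Parity-26565), definitionally. -/
theorem chenQuad_iff_record : ChenQuad ↔ OneSidedDegreeLadder.ChenQuad := Iff.rfl

/-- The born `ParityLift` is the record route's `ParityLift`, definitionally. -/
theorem parityLift_iff_record : ParityLift ↔ OneSidedDegreeLadder.ParityLift := Iff.rfl

/-- The born `UpperNonlinear` is the record route's `UpperNonlinear` (stmt-Parity-25176), definitionally. -/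
theorem upperNonlinear_iff_record : UpperNonlinear ↔ OneSidedDegreeLadder.UpperNonlinear := Iff.rfl

/-- The born `LinearCell` is the record route's `LinearCell` (stmt-Parity-25178), definitionally. -/
theorem linearCell_iff_record : LinearCell ↔ OneSidedDegreeLadder.LinearCell := Iff.rfl

/-! ## §1 One-member bookkeeping -/

/-- One-member bookkeeping: the `P_{deg}` count of the system `![q]` is the single-polynomial count. -/
theorem count_vec_natDegree (q : ℤ[X]) (x : ℕ) :
    ((Finset.range (x + 1)).filter fun n : ℕ =>
        (∀ i : Fin 1, 1 < ((![q] : Fin 1 → ℤ[X]) i).eval (n : ℤ)) ∧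
          ∑ i : Fin 1, ArithmeticFunction.cardFactors ((((![q] : Fin 1 → ℤ[X]) i).eval (n : ℤ)).toNat) ≤
            ∑ i : Fin 1, ((![q] : Fin 1 → ℤ[X]) i).natDegree).card =
      ((Finset.range (x + 1)).filter fun n : ℕ =>
        1 < q.eval (n : ℤ) ∧ ArithmeticFunction.cardFactors ((q.eval (n : ℤ)).toNat) ≤ q.natDegree).card := by
  refine congrArg Finset.card (Finset.filter_congr fun n _ => ?_)
  simp

/-- One-member bookkeeping: the Bateman–Horn main term of `![q]`. -/
theorem mainTerm_vec (q : ℤ[X]) (x : ℕ) :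
    batemanHornConst ![q] / (∏ i : Fin 1, (((![q] : Fin 1 → ℤ[X]) i).natDegree : ℝ)) * (x : ℝ) /
        Real.log x ^ 1 =
      batemanHornConst ![q] / (q.natDegree : ℝ) * (x : ℝ) / Real.log x := by
  simp

/-! ## §2 EXACTNESS of the cut `ChenRest ⟺ SinglePg ∧ ExcessLift` (hypothesis-free) -/

/-- NECESSITY of the piece S: `ChenRest ⟹ SinglePg` (two monotone relaxations: proportion `1 − ε ↦ 1/2 > 0`
and excess `1 ↦ deg f − 1`). -/
theorem singlePg_of_chenRest (hR : OneSidedDegreeLadder.ChenRest) : SinglePg := by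
  intro f hf hg
  have hex : ∃ i : Fin 1, 2 ≤ ((![f] : Fin 1 → ℤ[X]) i).natDegree := ⟨0, by simp; omega⟩
  have hnq : ¬ (1 = 1 ∧ ∀ i : Fin 1, ((![f] : Fin 1 → ℤ[X]) i).natDegree = 2) := by
    rintro ⟨-, h⟩
    have := h 0
    simp at this
    omega
  refine ⟨1 / 2, by norm_num, ?_⟩
  filter_upwards [hR 1 ![f] hf hex hnq (1 / 2) (by norm_num)] with x hx
  rw [mainTerm_vec, OneSidedDegreeLadder.LowerNonlinearGlue.count_single] at hx
  have h12 : (1 - 1 / 2 : ℝ) = 1 / 2 := by norm_num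
  rw [h12] at hx
  refine hx.trans ?_
  exact_mod_cast Finset.card_le_card fun n hn => by
    rw [Finset.mem_filter] at hn ⊢
    exact ⟨hn.1, hn.2.1, hn.2.2.trans (by omega)⟩

/-- NECESSITY of the residual E: `ChenRest ⟹ ExcessLift` (drop the inserted hypothesis). -/
theorem excessLift_of_chenRest (hR : OneSidedDegreeLadder.ChenRest) : ExcessLift :=
  fun k f hf hex hnq _ => hR k f hf hex hnq

/-- GLUE of the cut: `SinglePg → ExcessLift → ChenRest`.  On a single cell (`k = 1`) the system is `![f 0]` with
`deg (f 0) ≥ 3` (non-linear and not the quadratic cell), so `SinglePg` supplies the inserted hypothesis of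
`ExcessLift`; on `k ≥ 2` cells that hypothesis is vacuous. -/
theorem chenRest_of_pieces (hS : SinglePg) (hE : ExcessLift) : OneSidedDegreeLadder.ChenRest := by
  intro k f hf hex hnq
  refine hE k f hf hex hnq ?_
  rintro rfl
  rw [OneSidedDegreeLadder.LowerNonlinearGlue.vec_single_eq f] at hf hex hnq ⊢
  have h3 : 3 ≤ (f 0).natDegree := by
    by_contra h
    obtain ⟨i, hi⟩ := hex
    rw [Fin.fin_one_eq_zero i] at hi
    simp only [Matrix.cons_val_fin_one] at hi
    exact hnq ⟨rfl, fun i => by rw [Fin.fin_one_eq_zero i]; simp only [Matrix.cons_val_fin_one]; omega⟩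
  obtain ⟨θ, hθ, hev⟩ := hS (f 0) hf h3
  refine ⟨θ, hθ, ?_⟩
  filter_upwards [hev] with x hx
  rwa [mainTerm_vec, count_vec_natDegree]

/-- **EXACTNESS of the node (hypothesis-free):** `ChenRest ⟺ SinglePg ∧ ExcessLift`. -/
theorem chenRest_iff_pieces : OneSidedDegreeLadder.ChenRest ↔ SinglePg ∧ ExcessLift :=
  ⟨fun hR => ⟨singlePg_of_chenRest hR, excessLift_of_chenRest hR⟩, fun h => chenRest_of_pieces h.1 h.2⟩

/-- HONEST READING of the residual: given `SinglePg`, `ExcessLift` IS the parent leaf `ChenRest`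
(declared contraction; terminal notch, no successor). -/
theorem excessLift_iff_parent (hS : SinglePg) : ExcessLift ↔ OneSidedDegreeLadder.ChenRest :=
  ⟨fun hE => chenRest_of_pieces hS hE, excessLift_of_chenRest⟩

/-! ## §3 NECESSITY from the leaf, the conjunct and the root; exactness through the BORN `closes` -/

/-- The product of the degrees of a Bateman–Horn system is positive (as a real number). -/
theorem prod_natDegree_cast_pos {k : ℕ} {f : Fin k → ℤ[X]} (hf : IsBatemanHornSystem f) :
    0 < ∏ i, ((f i).natDegree : ℝ) :=
  prod_pos fun i _ => by exact_mod_cast hf.natDegree_pos i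

/-- The Bateman–Horn main term `C(f)/∏ deg · x/(log x)^k` is non-negative along `ℕ`. -/
theorem bhMainTerm_nonneg {k : ℕ} {f : Fin k → ℤ[X]} (hf : IsBatemanHornSystem f) (x : ℕ) :
    0 ≤ batemanHornConst f / (∏ i, ((f i).natDegree : ℝ)) * (x : ℝ) / Real.log x ^ k := by
  have hC : 0 < batemanHornConst f := (IsBatemanHornSystem.hasBatemanHornConst_holds hf).2
  have hD := prod_natDegree_cast_pos hf
  have hlog : 0 ≤ Real.log (x : ℝ) := Real.log_natCast_nonneg x
  positivity

/-- The prime count sits inside every excess count: `P_f(x) ≤ #{n ≤ x : all fᵢ(n) > 1, Σ Ω(fᵢ(n)) ≤ k + e}`. -/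
theorem polyPrimeCount_le_excessCount {k : ℕ} (f : Fin k → ℤ[X]) (x e : ℕ) :
    polyPrimeCount f x ≤
      ((Finset.range (x + 1)).filter fun n : ℕ =>
        (∀ i, 1 < (f i).eval (n : ℤ)) ∧
          ∑ i, ArithmeticFunction.cardFactors (((f i).eval (n : ℤ)).toNat) ≤ k + e).card := by
  unfold polyPrimeCount
  refine Finset.card_le_card fun n hn => ?_
  simp only [Finset.mem_filter] at hn ⊢
  refine ⟨hn.1, fun i => ?_, ?_⟩
  · obtain ⟨hpos, hpr⟩ := hn.2 i
    have h2 : (2 : ℤ) ≤ ((((f i).eval (n : ℤ)).toNat : ℕ) : ℤ) := by exact_mod_cast hpr.two_le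
    rw [Int.toNat_of_nonneg hpos.le] at h2
    linarith
  · have hs : ∑ i, ArithmeticFunction.cardFactors (((f i).eval (n : ℤ)).toNat) = ∑ _i : Fin k, 1 :=
      Finset.sum_congr rfl fun i _ => ArithmeticFunction.cardFactors_apply_prime (hn.2 i).2
    rw [hs]
    simp

/-- `BatemanHorn ⟹ LowerNonlinear` (the lower half of the asymptotic). -/
theorem lowerNonlinear_of_batemanHorn (h : BatemanHorn) : OneSidedDegreeLadder.LowerNonlinear := by
  intro k f hf _ ε hε
  obtain ⟨C, hC, hequiv⟩ := h k f hf
  have hCeq : batemanHornConst f = C := hC.batemanHornConst_eq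
  have hlo := Asymptotics.isLittleO_iff.mp hequiv.isLittleO hε
  filter_upwards [hlo] with x hx
  simp only [Pi.sub_apply, Real.norm_eq_abs, Fintype.card_fin] at hx
  have hv := bhMainTerm_nonneg hf x
  rw [hCeq] at hv ⊢
  rw [abs_of_nonneg hv] at hx
  have := (abs_le.mp hx).1
  linarith

/-- `BatemanHorn ⟹ UpperNonlinear` (the upper half of the asymptotic; born copy of stmt-Parity-25176). -/
theorem upperNonlinear_of_batemanHorn (h : BatemanHorn) : UpperNonlinear := by
  intro k f hf _ ε hε
  obtain ⟨C, hC, hequiv⟩ := h k f hf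
  have hCeq : batemanHornConst f = C := hC.batemanHornConst_eq
  have hlo := Asymptotics.isLittleO_iff.mp hequiv.isLittleO hε
  filter_upwards [hlo] with x hx
  simp only [Pi.sub_apply, Real.norm_eq_abs, Fintype.card_fin] at hx
  have hv := bhMainTerm_nonneg hf x
  rw [hCeq] at hv ⊢
  rw [abs_of_nonneg hv] at hx
  have := (abs_le.mp hx).2
  linarith

/-- `BatemanHorn ⟹ LinearCell` (restriction to linear systems; born copy of stmt-Parity-25178). -/
theorem linearCell_of_batemanHorn (h : BatemanHorn) : LinearCell := fun k f hf _ => h k f hf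

/-- `LowerNonlinear ⟹ ChenRest` (prime values are `P_{k+1}` values). -/
theorem chenRest_of_lowerNonlinear (hL : OneSidedDegreeLadder.LowerNonlinear) : OneSidedDegreeLadder.ChenRest := by
  intro k f hf hex _ ε hε
  filter_upwards [hL k f hf hex ε hε] with x hx
  exact hx.trans (by exact_mod_cast polyPrimeCount_le_excessCount f x 1)

/-- `LowerNonlinear ⟹ ParityLift` (drop the inserted hypotheses; born copy of the record item). -/
theorem parityLift_of_lowerNonlinear (hL : OneSidedDegreeLadder.LowerNonlinear) : ParityLift :=
  fun k f hf hex _ => hL k f hf hex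

/-- `LowerNonlinear ⟹ ChenQuad` (the quadratic cell; born copy of stmt-Parity-26565). -/
theorem chenQuad_of_lowerNonlinear (hL : OneSidedDegreeLadder.LowerNonlinear) : ChenQuad := by
  intro q hq hdeg ε hε
  have hex : ∃ i : Fin 1, 2 ≤ ((![q] : Fin 1 → ℤ[X]) i).natDegree := ⟨0, by simp [hdeg]⟩
  filter_upwards [hL 1 ![q] hq hex ε hε] with x hx
  rw [OneSidedDegreeLadder.LowerNonlinearGlue.mainTerm_single hdeg] at hx
  refine hx.trans ?_
  rw [← OneSidedDegreeLadder.LowerNonlinearGlue.count_single]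
  exact_mod_cast polyPrimeCount_le_excessCount ![q] x 1

/-- NECESSITY of the piece at the leaf: `LowerNonlinear ⟹ SinglePg`. -/
theorem singlePg_of_lowerNonlinear (hL : OneSidedDegreeLadder.LowerNonlinear) : SinglePg :=
  singlePg_of_chenRest (chenRest_of_lowerNonlinear hL)

/-- NECESSITY of the piece at the conjunct: `BatemanHorn ⟹ SinglePg`. -/
theorem singlePg_of_batemanHorn (h : BatemanHorn) : SinglePg :=
  singlePg_of_lowerNonlinear (lowerNonlinear_of_batemanHorn h)

/-- NECESSITY of the residual at the conjunct: `BatemanHorn ⟹ ExcessLift`. -/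
theorem excessLift_of_batemanHorn (h : BatemanHorn) : ExcessLift :=
  excessLift_of_chenRest (chenRest_of_lowerNonlinear (lowerNonlinear_of_batemanHorn h))

/-- Necessity of both pieces at the conjunct (hypothesis-free). -/
theorem pieces_of_batemanHorn (h : BatemanHorn) : SinglePg ∧ ExcessLift :=
  ⟨singlePg_of_batemanHorn h, excessLift_of_batemanHorn h⟩

/-- Necessity of both pieces at the root `Parity = BatemanHorn ∧ GeneralizedHardyLittlewood`. -/
theorem pieces_of_parity (h : _root_.Parity) : SinglePg ∧ ExcessLift := pieces_of_batemanHorn h.1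

/-- **Route-level exactness (six-way) through the BORN deciding theorem `closes`:** the conjunct equals
the conjunction of the six binders. -/
theorem batemanHorn_iff_pieces :
    BatemanHorn ↔ LinearCell ∧ UpperNonlinear ∧ ChenQuad ∧ ParityLift ∧ SinglePg ∧ ExcessLift :=
  ⟨fun h => ⟨linearCell_of_batemanHorn h, upperNonlinear_of_batemanHorn h,
      chenQuad_of_lowerNonlinear (lowerNonlinear_of_batemanHorn h),
      parityLift_of_lowerNonlinear (lowerNonlinear_of_batemanHorn h),
      singlePg_of_batemanHorn h, excessLift_of_batemanHorn h⟩,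
    fun h => closes h.1 h.2.1 h.2.2.1 h.2.2.2.1 h.2.2.2.2.1 h.2.2.2.2.2⟩

/-- Root: `Parity ⟺ (six binders) ∧ GeneralizedHardyLittlewood`. -/
theorem parity_iff_pieces :
    _root_.Parity ↔
      (LinearCell ∧ UpperNonlinear ∧ ChenQuad ∧ ParityLift ∧ SinglePg ∧ ExcessLift) ∧
        _root_.GeneralizedHardyLittlewood := by
  rw [← batemanHorn_iff_pieces]
  exact Iff.rfl

/-- The root from the six binders and the sibling conjunct. -/
theorem closes_root (hG : _root_.GeneralizedHardyLittlewood) (hLin : LinearCell) (hU : UpperNonlinear)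
    (hQ : ChenQuad) (hP : ParityLift) (hS : SinglePg) (hE : ExcessLift) : _root_.Parity :=
  ⟨closes hLin hU hQ hP hS hE, hG⟩

/-- The leaf after the cut: `LowerNonlinear ⟺ ChenQuad ∧ SinglePg ∧ ExcessLift ∧ ParityLift` (through the record's
CLOSED lower glue `lowerNonlinearGlue_holds`). -/
theorem lowerNonlinear_iff_pieces4 :
    OneSidedDegreeLadder.LowerNonlinear ↔ ChenQuad ∧ SinglePg ∧ ExcessLift ∧ ParityLift :=
  ⟨fun hL => ⟨chenQuad_of_lowerNonlinear hL, singlePg_of_lowerNonlinear hL,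
      excessLift_of_chenRest (chenRest_of_lowerNonlinear hL), parityLift_of_lowerNonlinear hL⟩,
    fun h => OneSidedDegreeLadder.lowerNonlinearGlue_holds h.1 (chenRest_of_pieces h.2.1 h.2.2.1) h.2.2.2⟩

end Summit.Parity.BatemanHorn.Theses.DegreeExcessLadder
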